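import Literature.Computability.Complexity.UmansFPDecode
import HarnessLib

/-!
# Umans' generator, machine level XIII: the searches of the generator (field data)

Literature / circuit complexity — derandomization. The generator of C. Umans, JCSS 67 (2003),
Thm. 6 ("`G` can be computed in `poly(n)` time given the truth table") must SET UP its finite
fields deterministically: an irreducible modulus `p ∈ F_h[z]` of degree `d` for `L = F_q[z]/(p)`
(§3, Lemma 7), a primitive element `α` of `L` (§4.1, the positions `α^{ri}`; §5, the generator
`Ẽ(αy), Ẽ(α²y), …`), and an element `β` generating a normal basis (§4.2, Def. 9). This file writes
the exhaustive searches as programs on bitmask lists (polynomial time because `|L| = q^d = poly(n)`)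
and proves what they find:

* `vecsOverL` (all lists of a given length over an alphabet, with an inactive-on-valid-inputs cap;
  `vecsOverL_spec`, `mem_vecsOverL`, `length_vecsOverL_le_cap`);
* `reduceModL`/`dividesL` (Horner reduction modulo a monic `g`, `dividesL_iff : … ↔ g ∣ p`),
  `irredTestL` (**`irredTestL_iff : … ↔ Irreducible (pOf M pc)`**: no monic divisor of degree
  `≤ d/2`), `findIrredL` (`findIrredL_spec`);
* `isZeroL`, `isOneL`, `powNeOneL` (`u, u², …, u^{P-1} ≠ 1`), `findPrimL` (`findPrimL_spec`);
* `frobRowsL`, `isNormalL` (`isNormalL_iff`: the coordinate rows of `u, u^q, …, u^{q^{d-1}}` have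
  trivial right kernel), `findNormalL` (`findNormalL_spec`).

Everything is proved; no named fact.

## References

* C. Umans, *Pseudo-random generators for all hardnesses*, JCSS 67 (2003), §3–§5 [Umans2003].
* R. Lidl, H. Niederreiter, *Finite Fields*, 2nd ed., CUP 1997, §3.2 (irreducibility by trial
  division), Thm. 2.8 (primitive elements), §2.3 (normal bases) [LidlNiederreiter1996].
-/

noncomputable section

namespace Literature.Computability.Complexity

open Polynomial Literature.InformationTheory.Coding
open Literature.InformationTheory.Coding.GF2X CodeFP
open Literature.LinearAlgebra.Matrix.ListGauss

namespace UmansFP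

variable (M : ℕ)

/-! ### All lists over an alphabet -/

/-- **All lists of length `d` over the alphabet `alpha`** (one more letter appended per round;
each round truncated to `cap` lists, a cap that is inactive when `|alpha|^d ≤ cap` and makes the
size unconditionally polynomial). [folklore] -/
def vecsOverL (cap : ℕ) (alpha : List ℕ) (d : ℕ) : List (List ℕ) :=
  (List.replicate d ()).foldl (fun acc _ => (acc.flatMap fun l => alpha.map fun a => l ++ [a]).take cap) [[]]

/-- One more round. [folklore] -/
theorem vecsOverL_succ (cap : ℕ) (alpha : List ℕ) (d : ℕ) :
    vecsOverL cap alpha (d + 1) = ((vecsOverL cap alpha d).flatMap fun l => alpha.map fun a => l ++ [a]).take cap := by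
  rw [vecsOverL, vecsOverL, List.replicate_succ', List.foldl_append, List.foldl_cons, List.foldl_nil]

/-- The frontier never exceeds the cap (from round `1` on). [folklore] -/
theorem length_vecsOverL_le_cap (cap : ℕ) (alpha : List ℕ) (d : ℕ) : (vecsOverL cap alpha d).length ≤ max 1 cap := by
  cases d with
  | zero => simp [vecsOverL]
  | succ d => rw [vecsOverL_succ, List.length_take]; omega

/-- **Members and count when the cap is inactive** (`|alpha|^d ≤ cap`, `alpha ≠ []`): exactly the
lists of length `d` with letters from `alpha`, `|alpha|^d` of them. [folklore] -/
theorem vecsOverL_spec {cap : ℕ} {alpha : List ℕ} (hal : 1 ≤ alpha.length) :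
    ∀ {d : ℕ}, alpha.length ^ d ≤ cap →
      (∀ l : List ℕ, l ∈ vecsOverL cap alpha d ↔ l.length = d ∧ ∀ x ∈ l, x ∈ alpha) ∧ (vecsOverL cap alpha d).length = alpha.length ^ d
  | 0, _ => ⟨fun l => by simp [vecsOverL]; rintro rfl; simp, rfl⟩
  | d + 1, hcap => by
    have hcap' : alpha.length ^ d ≤ cap := (Nat.pow_le_pow_right hal (Nat.le_succ d)).trans hcap
    obtain ⟨ihmem, ihlen⟩ := vecsOverL_spec hal hcap'
    have hlenflat : ((vecsOverL cap alpha d).flatMap fun l => alpha.map fun a => l ++ [a]).length = alpha.length ^ (d + 1) := by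
      rw [List.length_flatMap, pow_succ]
      have : ∀ l ∈ vecsOverL cap alpha d, ((fun l : List ℕ => alpha.map fun a => l ++ [a]) l).length = alpha.length := fun l _ => by simp
      rw [List.map_congr_left this, List.map_const', List.sum_replicate, ihlen, smul_eq_mul]
    have htake : vecsOverL cap alpha (d + 1) = (vecsOverL cap alpha d).flatMap fun l => alpha.map fun a => l ++ [a] := by
      rw [vecsOverL_succ]; exact List.take_of_length_le (by rw [hlenflat]; exact hcap)
    refine ⟨fun l => ?_, by rw [htake, hlenflat]⟩
    rw [htake, List.mem_flatMap]
    constructor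
    · rintro ⟨l', hl', hl⟩
      obtain ⟨a, ha, rfl⟩ := List.mem_map.1 hl
      obtain ⟨h1, h2⟩ := (ihmem l').1 hl'
      refine ⟨by rw [List.length_append, List.length_singleton, h1], fun x hx => ?_⟩
      rw [List.mem_append, List.mem_singleton] at hx
      rcases hx with hx | rfl
      · exact h2 x hx
      · exact ha
    · rintro ⟨hlen, hmem⟩
      have hne : l ≠ [] := fun h => by rw [h] at hlen; simp at hlen
      refine ⟨l.dropLast, (ihmem _).2 ⟨by rw [List.length_dropLast, hlen]; rfl, fun x hx => hmem x (List.mem_of_mem_dropLast hx)⟩,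
        List.mem_map.2 ⟨l.getLast hne, hmem _ (List.getLast_mem hne), List.dropLast_append_getLast hne⟩⟩

/-- Members, cap inactive. [folklore] -/
theorem mem_vecsOverL {cap : ℕ} {alpha : List ℕ} (hal : 1 ≤ alpha.length) {d : ℕ} (hcap : alpha.length ^ d ≤ cap) {l : List ℕ} :
    l ∈ vecsOverL cap alpha d ↔ l.length = d ∧ ∀ x ∈ l, x ∈ alpha := (vecsOverL_spec hal hcap).1 l

/-! ### Reduction modulo a monic polynomial, divisibility, irreducibility -/

/-- Adding a constant to the `z⁰`-coefficient. [folklore] -/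
def addHeadConstL (W : ℕ) (acc : List ℕ) (a : ℕ) : List ℕ :=
  match acc with
  | [] => []
  | x :: xs => xorW W x a :: xs

/-- **`p mod g` by Horner's rule** in `K[z]/(g)`, `g = pOf gc` monic: for each coefficient of `p`
from the top, `acc ← z · acc + p_i`. [cite: KnuthTAOCP2, §4.6.1] -/
def reduceModL (c : ℕ × ℕ × ℕ) (gc pl : List ℕ) : List ℕ :=
  pl.reverse.foldl (fun acc a => addHeadConstL c.1 (lmulz c gc acc) a) (List.replicate gc.length 0)

/-- **Divisibility test** `g ∣ p`: the remainder is `0`. [cite: LidlNiederreiter1996, §3.2] -/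
def dividesL (c : ℕ × ℕ × ℕ) (gc pl : List ℕ) : Bool := (reduceModL c gc pl).all fun x => x == 0

/-- **Irreducibility test** of `pOf pc` (degree `d`): no monic divisor of degree `e`,
`1 ≤ e ≤ d/2`, among all `q^e` candidates. [cite: LidlNiederreiter1996, §3.2 (trial division)] -/
def irredTestL (c : ℕ × ℕ × ℕ) (cap q : ℕ) (pc : List ℕ) : Bool :=
  (List.range (pc.length / 2 + 1)).all fun e => (e == 0) || (vecsOverL cap (List.range q) e).all fun gc => !(dividesL c gc (pc ++ [1]))

/-- **The search for the modulus**: the first list over `Hl` (the subfield `F_h`) of length `d`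
passing the irreducibility test. [cite: Umans2003, §3, Lemma 7] -/
def findIrredL (c : ℕ × ℕ × ℕ) (cap q d : ℕ) (Hl : List ℕ) : List ℕ :=
  ((vecsOverL cap Hl d).find? fun pc => irredTestL c cap q pc).getD []

section ReduceSpec

variable {M} {e : ℕ} {gc : List ℕ}

/-- Adding a constant to the head. [folklore] -/
theorem addHeadConstL_spec (he : 1 ≤ e) {v : List ℕ} (hv : LRep M e v) {a : ℕ} (ha : a < 2 ^ (M + 1)) :
    LRep M e (addHeadConstL (M + 2) v a) ∧ polyOfList M (addHeadConstL (M + 2) v a) = polyOfList M v + C (GF2.elt M a) := by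
  obtain ⟨hlen, hred⟩ := hv
  cases v with
  | nil => rw [List.length_nil] at hlen; omega
  | cons x xs =>
    obtain ⟨hx, hxlt⟩ := elt_xorW M (W := M + 2) (by omega) (hred x List.mem_cons_self) ha
    refine ⟨⟨by rw [addHeadConstL, List.length_cons, ← hlen, List.length_cons], fun y hy => ?_⟩, ?_⟩
    · rw [addHeadConstL, List.mem_cons] at hy
      rcases hy with rfl | hy
      · exact hxlt
      · exact hred y (List.mem_cons_of_mem x hy)
    · rw [addHeadConstL, polyOfList_cons, polyOfList_cons, hx, map_add]; ring

/-- **The Horner reduction computes `p mod g`** (as an element of `K[z]/(g)`), with a reduced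
representative. [cite: KnuthTAOCP2, §4.6.1] -/
theorem reduceModL_spec (hgc : LRep M e gc) (he : 1 ≤ e) : ∀ {pl : List ℕ}, KRed M pl →
    LRep M e (reduceModL (kctx M) gc pl) ∧ lElt M gc (reduceModL (kctx M) gc pl) = AdjoinRoot.mk (pOf M gc) (polyOfList M pl)
  | [], _ => by
    refine ⟨⟨by rw [reduceModL, List.reverse_nil, List.foldl_nil, List.length_replicate, hgc.1], fun x hx => ?_⟩, ?_⟩
    · rw [reduceModL, List.reverse_nil, List.foldl_nil] at hx
      rw [List.eq_of_mem_replicate hx]; exact Nat.two_pow_pos _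
    · rw [reduceModL, List.reverse_nil, List.foldl_nil, lElt, hgc.1, polyOfList_replicate_zero, polyOfList_nil]
  | a :: pl, hpl => by
    obtain ⟨h1, h2⟩ := reduceModL_spec hgc he (fun x hx => hpl x (List.mem_cons_of_mem a hx))
    have hstep : reduceModL (kctx M) gc (a :: pl) = addHeadConstL (M + 2) (lmulz (kctx M) gc (reduceModL (kctx M) gc pl)) a := by
      rw [reduceModL, reduceModL, List.reverse_cons, List.foldl_append, List.foldl_cons, List.foldl_nil]; rfl
    obtain ⟨hz, -⟩ := lmulz_spec M hgc he h1
    obtain ⟨ha1, ha2⟩ := addHeadConstL_spec he hz (hpl a List.mem_cons_self)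
    rw [hstep]
    refine ⟨ha1, ?_⟩
    rw [lElt, ha2, map_add, AdjoinRoot.mk_C, ← lElt, lElt_lmulz M hgc he h1, h2, polyOfList_cons, map_add, map_mul, AdjoinRoot.mk_C,
      AdjoinRoot.mk_X]
    ring

/-- A reduced representative is zero iff it represents zero. [folklore] -/
theorem lElt_eq_zero_iff (hgc : LRep M e gc) {v : List ℕ} (hv : LRep M e v) : lElt M gc v = 0 ↔ ∀ x ∈ v, x = 0 := by
  haveI : Nontrivial (GF2 M) := inferInstance
  rw [← polyOfList_eq_zero_iff M hv.2, lElt, AdjoinRoot.mk_eq_zero]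
  constructor
  · intro h
    refine Polynomial.eq_zero_of_dvd_of_degree_lt h ?_
    rw [degree_eq_natDegree (monic_pOf M gc).ne_zero, natDegree_pOf, hgc.1, ← hv.1]
    exact degree_polyOfList_lt M v
  · intro h; rw [h]; exact dvd_zero _

/-- **The divisibility test is correct.** [cite: LidlNiederreiter1996, §3.2] -/
theorem dividesL_iff (hgc : LRep M e gc) (he : 1 ≤ e) {pl : List ℕ} (hpl : KRed M pl) :
    dividesL (kctx M) gc pl = true ↔ pOf M gc ∣ polyOfList M pl := by
  obtain ⟨h1, h2⟩ := reduceModL_spec hgc he hpl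
  rw [dividesL, List.all_eq_true, ← AdjoinRoot.mk_eq_zero, ← h2, lElt_eq_zero_iff hgc h1]
  simp

end ReduceSpec

section IrredSpec

variable {M} {d : ℕ} {pc : List ℕ}

/-- The coefficient list with the leading `1` reads as the monic modulus. [folklore] -/
theorem polyOfList_append_one (pc : List ℕ) : polyOfList M (pc ++ [1]) = pOf M pc := by
  rw [polyOfList_append_singleton, GF2.elt, bitsPoly_one, map_one, C_1, one_mul, pOf, add_comm]

/-- Reducedness of the monic coefficient list. [folklore] -/
theorem KRed.append_one (hpc : LRep M d pc) : KRed M (pc ++ [1]) := by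
  intro x hx
  rw [List.mem_append, List.mem_singleton] at hx
  rcases hx with hx | rfl
  · exact hpc.2 x hx
  · exact Nat.one_lt_two_pow (by omega)

/-- The coefficient list (length `e`) of a polynomial. [folklore] -/
def coeffListL (M e : ℕ) (g : (GF2 M)[X]) : List ℕ := List.ofFn fun i : Fin e => toBits M (g.coeff i)

/-- A monic polynomial of degree `e` is `pOf` of its coefficient list. [folklore] -/
theorem pOf_coeffListL {e : ℕ} {g : (GF2 M)[X]} (hg : g.Monic) (hge : g.natDegree = e) : pOf M (coeffListL M e g) = g := by
  have hlen : (coeffListL M e g).length = e := List.length_ofFn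
  apply Polynomial.ext
  intro i
  rw [pOf, coeff_add, coeff_X_pow, coeff_polyOfList, hlen]
  by_cases hi : i < e
  · rw [if_neg (by omega), if_pos hi, zero_add, coeffListL, List.getD_eq_getElem _ _ (by rw [List.length_ofFn]; exact hi),
      List.getElem_ofFn, elt_toBits]
  · rw [if_neg hi, add_zero]
    by_cases hie : i = e
    · subst hie; rw [if_pos rfl, ← hge]; exact hg.coeff_natDegree.symm
    · rw [if_neg hie]; exact (coeff_eq_zero_of_natDegree_lt (by omega)).symm

/-- The coefficient list is a reduced list of the stated length over `[0, q)`. [folklore] -/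
theorem coeffListL_mem_vecsOverL {cap : ℕ} (e : ℕ) (hcap : (2 ^ (M + 1)) ^ e ≤ cap) (g : (GF2 M)[X]) :
    coeffListL M e g ∈ vecsOverL cap (List.range (2 ^ (M + 1))) e ∧ LRep M e (coeffListL M e g) := by
  have hmem : ∀ x ∈ coeffListL M e g, x < 2 ^ (M + 1) := fun x hx => by
    obtain ⟨i, rfl⟩ := List.mem_ofFn.1 hx; exact toBits_lt M _
  have hal : 1 ≤ (List.range (2 ^ (M + 1))).length := by rw [List.length_range]; exact Nat.one_le_two_pow
  exact ⟨(mem_vecsOverL hal (by rw [List.length_range]; exact hcap)).2 ⟨List.length_ofFn, fun x hx => List.mem_range.2 (hmem x hx)⟩,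
    ⟨List.length_ofFn, hmem⟩⟩

/-- **The irreducibility test is correct** for a reduced coefficient list of length `d ≥ 1`.
[cite: LidlNiederreiter1996, §3.2] -/
theorem irredTestL_iff {cap : ℕ} (hpc : LRep M d pc) (hd : 1 ≤ d) (hcap : (2 ^ (M + 1)) ^ (d / 2) ≤ cap) :
    irredTestL (kctx M) cap (2 ^ (M + 1)) pc = true ↔ Irreducible (pOf M pc) := by
  have hal : 1 ≤ (List.range (2 ^ (M + 1))).length := by rw [List.length_range]; exact Nat.one_le_two_pow
  have hcape : ∀ e, e ≤ d / 2 → (2 ^ (M + 1)) ^ e ≤ cap := fun e he => (Nat.pow_le_pow_right Nat.one_le_two_pow he).trans hcap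
  have hmon := monic_pOf M pc
  have hdeg : (pOf M pc).natDegree = d := by rw [natDegree_pOf, hpc.1]
  have hp1 : pOf M pc ≠ 1 := fun h => by have := congrArg natDegree h; rw [hdeg, natDegree_one] at this; omega
  rw [hmon.irreducible_iff_natDegree', irredTestL, List.all_eq_true, hpc.1, hdeg]
  simp only [List.mem_range, Bool.or_eq_true, beq_iff_eq, List.all_eq_true, Bool.not_eq_true']
  constructor
  · intro h
    refine ⟨hp1, fun f g hf hg hfg hmemI => ?_⟩
    rw [Finset.mem_Ioc] at hmemI
    obtain ⟨hmem, hrep⟩ := coeffListL_mem_vecsOverL (M := M) g.natDegree (hcape _ hmemI.2) g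
    rcases h g.natDegree (by omega) with h0 | hall
    · omega
    · have := hall _ hmem
      rw [← Bool.not_eq_true, dividesL_iff hrep (by omega) (KRed.append_one hpc), polyOfList_append_one, pOf_coeffListL hg rfl] at this
      exact this (Dvd.intro_left _ hfg)
  · rintro ⟨-, h⟩ e he
    rcases Nat.eq_zero_or_pos e with rfl | hepos
    · exact Or.inl rfl
    · refine Or.inr fun gc hgc => ?_
      obtain ⟨hlen, hmem⟩ := (mem_vecsOverL hal (by rw [List.length_range]; exact hcape e (by omega))).1 hgc
      have hrep : LRep M e gc := ⟨hlen, fun x hx => List.mem_range.1 (hmem x hx)⟩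
      rw [← Bool.not_eq_true, dividesL_iff hrep hepos (KRed.append_one hpc), polyOfList_append_one]
      rintro ⟨k, hk⟩
      have hk' : (pOf M gc * k).Monic := by rw [← hk]; exact hmon
      have hkmon : k.Monic := Monic.of_mul_monic_left (monic_pOf M gc) hk'
      have := h k (pOf M gc) hkmon (monic_pOf M gc) (by rw [mul_comm]; exact hk.symm)
      apply this
      rw [Finset.mem_Ioc, natDegree_pOf, hlen]
      exact ⟨hepos, by omega⟩

/-- **The search for the modulus succeeds** if some candidate is irreducible: the result is a
candidate (length `d`, entries from `Hl`) and `pOf` of it is irreducible. [cite: Umans2003, §3, Lemma 7] -/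
theorem findIrredL_spec {cap : ℕ} {Hl : List ℕ} (hHl : ∀ x ∈ Hl, x < 2 ^ (M + 1)) (hHl1 : 1 ≤ Hl.length) (hd : 1 ≤ d)
    (hcapH : Hl.length ^ d ≤ cap) (hcap : (2 ^ (M + 1)) ^ (d / 2) ≤ cap)
    (hex : ∃ pc ∈ vecsOverL cap Hl d, Irreducible (pOf M pc)) :
    findIrredL (kctx M) cap (2 ^ (M + 1)) d Hl ∈ vecsOverL cap Hl d ∧ Irreducible (pOf M (findIrredL (kctx M) cap (2 ^ (M + 1)) d Hl)) := by
  have hrep : ∀ pc ∈ vecsOverL cap Hl d, LRep M d pc := fun pc hpc => by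
    obtain ⟨h1, h2⟩ := (mem_vecsOverL hHl1 hcapH).1 hpc; exact ⟨h1, fun x hx => hHl x (h2 x hx)⟩
  obtain ⟨pc₀, hpc₀, hirr⟩ := hex
  have hsome : ((vecsOverL cap Hl d).find? fun pc => irredTestL (kctx M) cap (2 ^ (M + 1)) pc).isSome = true :=
    (List.find?_isSome (p := fun pc => irredTestL (kctx M) cap (2 ^ (M + 1)) pc)).2 ⟨pc₀, hpc₀, (irredTestL_iff (hrep pc₀ hpc₀) hd hcap).2 hirr⟩
  obtain ⟨pc, hpc⟩ := Option.isSome_iff_exists.1 hsome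
  have hmem := List.mem_of_find?_eq_some hpc
  have htest := List.find?_some hpc
  rw [findIrredL, hpc, Option.getD_some]
  exact ⟨hmem, (irredTestL_iff (hrep pc hmem) hd hcap).1 htest⟩

end IrredSpec

/-! ### The primitive element -/

/-- Zero test of an `L`-list. [folklore] -/
def isZeroL (u : List ℕ) : Bool := u == List.replicate u.length 0

/-- Unit test of an `L`-list (`[1, 0, …, 0]`). [folklore] -/
def isOneL (u : List ℕ) : Bool := u == lone u.length

/-- **`u, u², …, u^{P-1}` are all `≠ 1`** (the order of `u` is at least `P`).
[cite: LidlNiederreiter1996, Thm. 2.8 (primitive elements)] -/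
def powNeOneL (c : ℕ × ℕ × ℕ) (pc u : List ℕ) (P : ℕ) : Bool :=
  ((List.replicate (P - 1) ()).foldl (fun st _ => (lmul c pc st.1 u, st.2 && !(isOneL st.1))) (u, true)).2

/-- **The search for a primitive element**: the first nonzero `u` with `u, …, u^{P-1} ≠ 1`.
[cite: Umans2003, §4.1; LidlNiederreiter1996, Thm. 2.8] -/
def findPrimL (c : ℕ × ℕ × ℕ) (cap q : ℕ) (pc : List ℕ) (P : ℕ) : List ℕ :=
  ((vecsOverL cap (List.range q) pc.length).find? fun u => !(isZeroL u) && powNeOneL c pc u P).getD []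

section PrimSpec

variable {M} {d : ℕ} {pc : List ℕ}

/-- **Reduced representatives are unique.** [folklore] -/
theorem lElt_injOn (hpc : LRep M d pc) {u v : List ℕ} (hu : LRep M d u) (hv : LRep M d v) (h : lElt M pc u = lElt M pc v) : u = v := by
  haveI : CharP (GF2 M) 2 := GF2.charP M
  -- `u - v` (entrywise `xor`) represents `0`
  obtain ⟨hw, hwpoly⟩ := ladd_spec M hu hv
  have h0 : lElt M pc (ladd (M + 2) u v) = 0 := by
    rw [lElt, hwpoly, ← CharTwo.sub_eq_add, map_sub, ← lElt, ← lElt, h, sub_self]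
  have hzero := (lElt_eq_zero_iff hpc hw).1 h0
  refine List.ext_getElem (by rw [hu.1, hv.1]) fun j h1 h2 => ?_
  have hj : j < d := by rw [← hu.1]; exact h1
  have hx : xorW (M + 2) (u.getD j 0) (v.getD j 0) = 0 := by
    have hent : (ladd (M + 2) u v).getD j 0 = xorW (M + 2) (u.getD j 0) (v.getD j 0) := by
      rw [ladd, List.getD_eq_getElem _ _ (by rw [List.length_zipWith, hu.1, hv.1, min_self]; exact hj), List.getElem_zipWith,
        List.getD_eq_getElem _ _ h1, List.getD_eq_getElem _ _ h2]
    rw [← hent]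
    exact hzero _ (by rw [List.getD_eq_getElem _ _ (by rw [hw.1]; exact hj)]; exact List.getElem_mem _)
  have hult : u.getD j 0 < 2 ^ (M + 2) := (hu.getD_lt j).trans (Nat.pow_lt_pow_right (by norm_num) (by omega))
  have hvlt : v.getD j 0 < 2 ^ (M + 2) := (hv.getD_lt j).trans (Nat.pow_lt_pow_right (by norm_num) (by omega))
  rw [xorW_eq_of_lt hult hvlt] at hx
  have e : u.getD j 0 = v.getD j 0 :=
    calc u.getD j 0 = u.getD j 0 ^^^ 0 := (Nat.xor_zero _).symm
      _ = u.getD j 0 ^^^ (v.getD j 0 ^^^ v.getD j 0) := by rw [Nat.xor_self]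
      _ = (u.getD j 0 ^^^ v.getD j 0) ^^^ v.getD j 0 := by rw [Nat.xor_assoc]
      _ = v.getD j 0 := by rw [hx, Nat.zero_xor]
  rwa [List.getD_eq_getElem _ 0 h1, List.getD_eq_getElem _ 0 h2] at e

/-- The zero test. [folklore] -/
theorem isZeroL_iff (hpc : LRep M d pc) {u : List ℕ} (hu : LRep M d u) : isZeroL u = true ↔ lElt M pc u = 0 := by
  rw [isZeroL, beq_iff_eq, lElt_eq_zero_iff hpc hu]
  constructor
  · intro h x hx; rw [h] at hx; exact List.eq_of_mem_replicate hx
  · intro h; exact List.eq_replicate_iff.2 ⟨rfl, h⟩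

/-- The unit test. [folklore] -/
theorem isOneL_iff (hpc : LRep M d pc) (hd : 1 ≤ d) {u : List ℕ} (hu : LRep M d u) : isOneL u = true ↔ lElt M pc u = 1 := by
  obtain ⟨h1, h2⟩ := lone_spec M hpc hd
  rw [isOneL, beq_iff_eq, hu.1, ← h2]
  exact ⟨fun h => by rw [h], fun h => lElt_injOn hpc hu h1 h⟩

/-- **The power test is correct**: `u^k ≠ 1` for `1 ≤ k < P`. [cite: LidlNiederreiter1996, Thm. 2.8] -/
theorem powNeOneL_iff (hpc : LRep M d pc) (hd : 1 ≤ d) {u : List ℕ} (hu : LRep M d u) (P : ℕ) :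
    powNeOneL (kctx M) pc u P = true ↔ ∀ k, 1 ≤ k → k < P → lElt M pc u ^ k ≠ 1 := by
  -- invariant after `j` rounds: `(u^{j+1}, [∀ k ∈ [1, j], u^k ≠ 1])`
  have inv : ∀ j : ℕ, let st := (List.replicate j ()).foldl (fun st _ => (lmul (kctx M) pc st.1 u, st.2 && !(isOneL st.1))) (u, true)
      LRep M d st.1 ∧ lElt M pc st.1 = lElt M pc u ^ (j + 1) ∧ (st.2 = true ↔ ∀ k, 1 ≤ k → k ≤ j → lElt M pc u ^ k ≠ 1) := by
    intro j
    induction j with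
    | zero => exact ⟨hu, by rw [zero_add, pow_one]; rfl, ⟨fun _ k hk hk0 => absurd hk0 (by omega), fun _ => rfl⟩⟩
    | succ j ih =>
      obtain ⟨ih1, ih2, ih3⟩ := ih
      simp only [List.replicate_succ', List.foldl_append, List.foldl_cons, List.foldl_nil]
      set st := (List.replicate j ()).foldl (fun st _ => (lmul (kctx M) pc st.1 u, st.2 && !(isOneL st.1))) (u, true)
      obtain ⟨hm1, hm2⟩ := lmul_spec M hpc hd ih1 hu
      refine ⟨hm1, by rw [hm2, ih2, ← pow_succ], ?_⟩
      rw [Bool.and_eq_true, ih3, Bool.not_eq_true', ← Bool.not_eq_true, isOneL_iff hpc hd ih1, ih2]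
      constructor
      · rintro ⟨hA, hB⟩ k hk1 hk2
        rcases Nat.lt_or_ge k (j + 1) with hlt | hge
        · exact hA k hk1 (by omega)
        · have : k = j + 1 := by omega
          subst this; exact hB
      · intro h
        exact ⟨fun k hk1 hk2 => h k hk1 (by omega), h (j + 1) (by omega) le_rfl⟩
  obtain ⟨-, -, h3⟩ := inv (P - 1)
  rw [powNeOneL, h3]
  constructor
  · intro h k hk1 hk2; exact h k hk1 (by omega)
  · intro h k hk1 hk2; exact h k hk1 (by omega)

/-- **The search for a primitive element succeeds** if some candidate passes: the result is a
reduced list representing a nonzero element all of whose powers below `P` differ from `1`.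
[cite: Umans2003, §4.1; LidlNiederreiter1996, Thm. 2.8] -/
theorem findPrimL_spec {cap : ℕ} (hpc : LRep M d pc) (hd : 1 ≤ d) (hcap : (2 ^ (M + 1)) ^ d ≤ cap) {P : ℕ}
    (hex : ∃ u : List ℕ, LRep M d u ∧ lElt M pc u ≠ 0 ∧ ∀ k, 1 ≤ k → k < P → lElt M pc u ^ k ≠ 1) :
    let u := findPrimL (kctx M) cap (2 ^ (M + 1)) pc P
    LRep M d u ∧ lElt M pc u ≠ 0 ∧ ∀ k, 1 ≤ k → k < P → lElt M pc u ^ k ≠ 1 := by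
  intro u
  have hal : 1 ≤ (List.range (2 ^ (M + 1))).length := by rw [List.length_range]; exact Nat.one_le_two_pow
  have hcap' : (List.range (2 ^ (M + 1))).length ^ pc.length ≤ cap := by rw [List.length_range, hpc.1]; exact hcap
  have hrep : ∀ v ∈ vecsOverL cap (List.range (2 ^ (M + 1))) pc.length, LRep M d v := fun v hv => by
    obtain ⟨h1, h2⟩ := (mem_vecsOverL hal hcap').1 hv; exact ⟨by rw [h1, hpc.1], fun x hx => List.mem_range.1 (h2 x hx)⟩
  have htest : ∀ v, LRep M d v → ((!(isZeroL v) && powNeOneL (kctx M) pc v P) = true ↔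
      lElt M pc v ≠ 0 ∧ ∀ k, 1 ≤ k → k < P → lElt M pc v ^ k ≠ 1) := fun v hv => by
    rw [Bool.and_eq_true, Bool.not_eq_true', ← Bool.not_eq_true, isZeroL_iff hpc hv, powNeOneL_iff hpc hd hv]
  obtain ⟨u₀, hu₀, h0, hpow⟩ := hex
  have hmem₀ : u₀ ∈ vecsOverL cap (List.range (2 ^ (M + 1))) pc.length :=
    (mem_vecsOverL hal hcap').2 ⟨by rw [hu₀.1, hpc.1], fun x hx => List.mem_range.2 (hu₀.2 x hx)⟩
  have hsome := (List.find?_isSome (p := fun v => !(isZeroL v) && powNeOneL (kctx M) pc v P)).2 ⟨u₀, hmem₀, (htest u₀ hu₀).2 ⟨h0, hpow⟩⟩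
  obtain ⟨v, hv⟩ := Option.isSome_iff_exists.1 hsome
  have hmem := List.mem_of_find?_eq_some hv
  have hvt := List.find?_some hv
  have hu : u = v := by show ((vecsOverL _ _ _).find? _).getD [] = v; rw [hv, Option.getD_some]
  rw [hu]
  exact ⟨hrep v hmem, (htest v (hrep v hmem)).1 hvt⟩

end PrimSpec

/-! ### The normal element -/

/-- The coordinate rows of `u, u^q, …, u^{q^{d-1}}` (`q = 2^{logq}`, by iterated squaring).
[cite: Umans2003, §4.2, Def. 9 (normal basis)] -/
def frobRowsL (c : ℕ × ℕ × ℕ) (pc u : List ℕ) (logq : ℕ) : List (List ℕ) :=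
  (List.range pc.length).map fun j => lsqIter c pc u (logq * j)

/-- **Normality test**: the Frobenius rows have trivial right kernel. [cite: LidlNiederreiter1996, §2.3] -/
def isNormalL (c : ℕ × ℕ × ℕ) (pc u : List ℕ) (logq : ℕ) : Bool := (kerVecK c pc.length (frobRowsL c pc u logq)).isNone

/-- **The search for a normal element.** [cite: Umans2003, §4.2, Def. 9] -/
def findNormalL (c : ℕ × ℕ × ℕ) (cap q : ℕ) (pc : List ℕ) (logq : ℕ) : List ℕ :=
  ((vecsOverL cap (List.range q) pc.length).find? fun u => isNormalL c pc u logq).getD []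

section NormalSpec

variable {M} {d : ℕ} {pc : List ℕ}

/-- The Frobenius rows are reduced of length `d` and represent the powers `u^{2^{logq j}}`. [folklore] -/
theorem frobRowsL_spec (hpc : LRep M d pc) (hd : 1 ≤ d) {u : List ℕ} (hu : LRep M d u) (logq : ℕ) :
    (frobRowsL (kctx M) pc u logq).length = d ∧
      ∀ j, (hj : j < d) → LRep M d ((frobRowsL (kctx M) pc u logq).getD j []) ∧
        lElt M pc ((frobRowsL (kctx M) pc u logq).getD j []) = lElt M pc u ^ (2 ^ (logq * j)) := by
  refine ⟨by rw [frobRowsL, List.length_map, List.length_range, hpc.1], fun j hj => ?_⟩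
  rw [frobRowsL, List.getD_eq_getElem _ _ (by rw [List.length_map, List.length_range, hpc.1]; exact hj), List.getElem_map, List.getElem_range]
  exact lsqIter_spec M hpc hd hu (logq * j)

/-- **The normality test is correct**: `true` iff no nonzero vector `v ∈ K^d` is orthogonal to all
coordinate rows of `u^{q^j}` (`dot` of the interpreted row with `v`). [cite: LidlNiederreiter1996, §2.3] -/
theorem isNormalL_iff (hpc : LRep M d pc) (hd : 1 ≤ d) {u : List ℕ} (hu : LRep M d u) (logq : ℕ) :
    isNormalL (kctx M) pc u logq = true ↔
      ∀ v : List (GF2 M), v.length = d → (∀ r ∈ frobRowsL (kctx M) pc u logq, dot (castVec M r) v = 0) → ∀ x ∈ v, x = 0 := by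
  obtain ⟨hlen, hrows⟩ := frobRowsL_spec hpc hd hu logq
  have hrowlen : ∀ r ∈ frobRowsL (kctx M) pc u logq, r.length = pc.length := fun r hr => by
    obtain ⟨j, hj, rfl⟩ := List.getElem_of_mem hr
    rw [hlen] at hj
    rw [← List.getD_eq_getElem _ [] (by rw [hlen]; exact hj), hpc.1]; exact (hrows j hj).1.1
  have hred : KRedRows M (frobRowsL (kctx M) pc u logq) := fun r hr => by
    obtain ⟨j, hj, rfl⟩ := List.getElem_of_mem hr
    rw [hlen] at hj
    rw [← List.getD_eq_getElem _ [] (by rw [hlen]; exact hj)]; exact (hrows j hj).1.2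
  rw [isNormalL, Option.isNone_iff_eq_none]
  constructor
  · intro hnone v hv horth
    by_contra hne
    push Not at hne
    have := kerVecK_complete hrowlen hred v (by rw [hv, hpc.1]) hne horth
    rw [hnone] at this; exact Bool.false_ne_true this
  · intro h
    cases hk : kerVecK (kctx M) pc.length (frobRowsL (kctx M) pc u logq) with
    | none => rfl
    | some w =>
      obtain ⟨hwlen, -, ⟨x, hx, hx0⟩, horth⟩ := kerVecK_sound hrowlen hred hk
      exfalso
      have := h (castVec M w) (by rw [length_castVec, hwlen, hpc.1]) horth (GF2.elt M x) (List.mem_map.2 ⟨x, hx, rfl⟩)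
      exact hx0 this

/-- **The search for a normal element succeeds** if some candidate passes. [cite: Umans2003, §4.2, Def. 9] -/
theorem findNormalL_spec {cap : ℕ} (hpc : LRep M d pc) (hcap : (2 ^ (M + 1)) ^ d ≤ cap) {logq : ℕ}
    (hex : ∃ u : List ℕ, LRep M d u ∧ isNormalL (kctx M) pc u logq = true) :
    let u := findNormalL (kctx M) cap (2 ^ (M + 1)) pc logq
    LRep M d u ∧ isNormalL (kctx M) pc u logq = true := by
  intro u
  have hal : 1 ≤ (List.range (2 ^ (M + 1))).length := by rw [List.length_range]; exact Nat.one_le_two_pow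
  have hcap' : (List.range (2 ^ (M + 1))).length ^ pc.length ≤ cap := by rw [List.length_range, hpc.1]; exact hcap
  have hrep : ∀ v ∈ vecsOverL cap (List.range (2 ^ (M + 1))) pc.length, LRep M d v := fun v hv => by
    obtain ⟨h1, h2⟩ := (mem_vecsOverL hal hcap').1 hv; exact ⟨by rw [h1, hpc.1], fun x hx => List.mem_range.1 (h2 x hx)⟩
  obtain ⟨u₀, hu₀, ht₀⟩ := hex
  have hmem₀ : u₀ ∈ vecsOverL cap (List.range (2 ^ (M + 1))) pc.length :=
    (mem_vecsOverL hal hcap').2 ⟨by rw [hu₀.1, hpc.1], fun x hx => List.mem_range.2 (hu₀.2 x hx)⟩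
  have hsome := (List.find?_isSome (p := fun v => isNormalL (kctx M) pc v logq)).2 ⟨u₀, hmem₀, ht₀⟩
  obtain ⟨v, hv⟩ := Option.isSome_iff_exists.1 hsome
  have hu : u = v := by show ((vecsOverL _ _ _).find? _).getD [] = v; rw [hv, Option.getD_some]
  rw [hu]
  have hvt := List.find?_some hv
  exact ⟨hrep v (List.mem_of_find?_eq_some hv), hvt⟩

end NormalSpec

end UmansFP

end Literature.Computability.Complexity

end
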